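import Summits.ABC.IUTFork.Cor312OrbitCoveringBarrier
import HarnessLib

/-!
# [IUTchIII] Cor. 3.12 — the ORBIT-COVERING bed COV, VII: the invariant-container bound for the HULL and the Licence; the π-adic-shape no-go at `j = 2`

Proof-only record file (D-0012; folklore lemmas, no definition, no `Prop` fact, nothing asserted about print) of the abc-iut cell (IUT REPAIR branch B,
sub-cell B3 Joshi, seat abc-iut-rp-j3 gen 3; rung LADDER-ABC:A2.B ⊇ A2.RP). Sequel of `Cor312OrbitCovering{Shells,…,Witness,Barrier}` (the honest
orbit-COVERING bed COV and its necessary side «covering needs a Θ-coordinate as shallow as the q-image»), imported, not restated. TAKES NO SIDE on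
[IUTchIII] Cor. 3.12 or on any author; typed ≠ proved; instantiated ≠ endorsed.

THIS FILE:
* §20 MODEL-FREE (any situation, any setting, any frame): if a HULL-SET `H ∈ Hul` contains the (Ind3)-region and is mapped into itself by every
  indeterminacy, then the holomorphic hull `ⁿ˒°𝒰_{j,v_ℚ}` lies in `H` (`thetaHull_subset_of_invariant_hul`) — so **the (xi-f) Licence needs the q-pilot
  region INSIDE every indeterminacy-invariant hull-set containing the Θ-image** (`qRegion_subset_of_licence_of_invariant_hul`). For ball-preserving
  indeterminacies and ball-shaped hull-sets: inside the SMALLEST BALL containing the Θ-image. (abc-iut-w5-d068's `IndTrivial.licence_iff` is the case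
  where the Θ-image itself is invariant; rp-h3's `CandDupuyHilado32.orbit_barrier_licence` the case `OrbitInside`.)
* §21 IN THE COVERING SHELLS, the quantitative form for UNIONS: if every depth of `kΘ` is `≥ a` and SOME depth of `kq` is `< a`, the orbit-union of
  `glat kΘ` does NOT cover `glat kq` (`not_covers_of_minDepth_lt`), for ANY subgroup of the ball-preserving ⟨(Ind1)∪(Ind2)⟩ of `covShells`.
* §22 THE π-ADIC-SHAPE INSTANCE at `j = 2` (the shape theta values can actually have in a ramified quadratic `K_v = ℚ_p(π)`, `π² = p·u`, read on the
  `ℤ_p`-basis `{1, π}` of `𝒪_{K_v}` placed in the LAST tensor factor — [IUTchIII] Prop. 3.4 (ii): the theta value `q^{j²}` sits in the factor labelled `j`):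
  `q = π^{e₀}` gives the q-image depths `(⌈e₀/2⌉, ⌊e₀/2⌋)` on the last factor's two coordinates and the Θ-image `q^{4} = π^{4e₀} = p^{2e₀}·u'` the
  ISOTROPIC depth `2e₀`; since `⌊e₀/2⌋ < 2e₀` for `e₀ ≥ 1`, **no ball-preserving indeterminacy group makes the orbit-union of such a Θ-image cover such a
  q-image** (`piAdicShape_not_covers`): at π-adic shapes the covering door of COV is SHUT at `j = 2` — the anisotropy theta values supply (one π-step,
  and none at all when `j²e₀` is even) is far below the spread `1 … 25` that COV uses (`cov_depth_spread`). The toy does not model [IUTchI] Def. 3.1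
  data; it models the depth bookkeeping of `π^e·𝒪_{K_v}` in a `ℤ_p`-basis (no side taken on whether print's (Ind2) preserves balls).
[claim: Mochizuki2012, status: disputed] for every IUT noun. [cite: ScholzeStix2018, §2.2 pp. 9–10] [cite: DupuyHilado2020, §6.2]
-/

noncomputable section

open Set

namespace Summit.ABC.IUTFork.Cor312Vol

namespace CoveringWitness

open Thm311 Cor312 Cor312.Checks Cor312.IdentifiedNonVacuity Literature.IUT.LogThetaLattice

/-! ## 20. Model-free: the hull and the Licence are trapped in every invariant hull-set containing the Θ-image -/

section General

variable {T : ThetaIndex} (S : Situation T) (P : Cor312.Setting S)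

/-- **THE HULL IS TRAPPED IN EVERY INVARIANT HULL-SET CONTAINER.** If `H` is a hull-set of the frame at `(j, v_ℚ)` containing the (Ind3)-region and
mapped into itself by every element of ⟨(Ind1) ∪ (Ind2)⟩, then `ⁿ˒°𝒰_{j,v_ℚ} ⊆ H`. [folklore] -/
theorem thetaHull_subset_of_invariant_hul {j : T.Label} {vQ : T.VQ} {H : Set (S.L.Packet j vQ)} (hH : H ∈ (P.frame j vQ).Hul)
    (hB : P.thetaRegion3 j vQ ⊆ H) (hinv : ∀ Φ ∈ Setting.indGroup S, Φ j vQ '' H ⊆ H) : P.thetaHull j vQ ⊆ H :=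
  (P.frame j vQ).hull_subset_of_mem hH (sUnion_possibleImages_subset_of_invariant S P hB hinv)

/-- **WHAT THE LICENCE NEEDS**: under the (xi-f) Licence, at every label of `𝔽_l^⋇` the q-pilot region lies inside EVERY indeterminacy-invariant
hull-set containing the Θ-image. (For ball-preserving indeterminacies: inside the smallest ball containing the Θ-image.) [folklore] -/
theorem qRegion_subset_of_licence_of_invariant_hul (hL : Thm311ToCor312.Licence P) (i : Fin T.lstar) (vQ : T.VQ)
    {H : Set (S.L.Packet (Setting.labelSucc i) vQ)} (hH : H ∈ (P.frame _ vQ).Hul) (hB : P.thetaRegion3 _ vQ ⊆ H)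
    (hinv : ∀ Φ ∈ Setting.indGroup S, Φ _ vQ '' H ⊆ H) : P.qRegion (Setting.labelSucc i) vQ ⊆ H :=
  (hL i vQ).trans (thetaHull_subset_of_invariant_hul S P hH hB hinv)

/-- Contrapositive: a q-region NOT contained in some invariant hull-set container of the Θ-image REFUTES the Licence. [folklore] -/
theorem not_licence_of_not_subset (i : Fin T.lstar) (vQ : T.VQ) {H : Set (S.L.Packet (Setting.labelSucc i) vQ)}
    (hH : H ∈ (P.frame _ vQ).Hul) (hB : P.thetaRegion3 _ vQ ⊆ H) (hinv : ∀ Φ ∈ Setting.indGroup S, Φ _ vQ '' H ⊆ H)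
    (hq : ¬ P.qRegion (Setting.labelSucc i) vQ ⊆ H) : ¬ Thm311ToCor312.Licence P := fun hL =>
  hq (qRegion_subset_of_licence_of_invariant_hul S P hL i vQ hH hB hinv)

end General

/-! ## 21. In the covering shells: no covering when the Θ-image is everywhere deeper than some q-coordinate -/

variable (p : ℕ) [hp : Fact p.Prime] {j : toyIndex.Label} {vQ : toyIndex.VQ}

/-- **NO COVERING ACROSS A DEPTH GAP**: if every coordinate depth of `kΘ` is `≥ a` while some coordinate depth of `kq` is `< a`, then `glat kq` is NOT
covered by the ⟨(Ind1)∪(Ind2)⟩-orbit-union of `glat kΘ` (the union stays in `p^a·𝓘`, which misses `p^{kq c}·e_c`). Holds for every ball-preserving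
indeterminacy group, whatever its size. [folklore] -/
theorem not_covers_of_minDepth_lt {kΘ kq : Idx j → ℕ} {a : ℕ} (hΘ : ∀ c, a ≤ kΘ c) (hq : ∃ c, kq c < a) :
    ¬ glat p vQ kq ⊆ ⋃₀ {U | ∃ Φ ∈ covGroup, U = Φ j vQ '' glat p vQ kΘ} := fun h => by
  obtain ⟨c, hc⟩ := hq
  have hx : ((p : ℚ) ^ kq c) • ePt j vQ c ∈ glat p vQ kq :=
    (pow_smul_ePt_mem_glat_iff p vQ kq c (kq c)).2 le_rfl
  have hx' : ((p : ℚ) ^ kq c) • ePt j vQ c ∈ ball p j vQ a := sUnion_orbit_glat_subset_ball p hΘ (h hx)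
  exact absurd ((pow_smul_ePt_mem_glat_iff p vQ _ c _).1 hx') (by omega)

/-! ## 22. The π-adic shape at `j = 2`: depths `(⌈e₀/2⌉, ⌊e₀/2⌋)` versus the isotropic `2e₀` — never a covering -/

/-- The LAST-FACTOR depth profile `(a on the coordinate 1 = "𝟙-direction", b on the coordinate π)` of `π^e·𝒪_{K_v}^{⊗(j+1)}`-shaped regions read on the
`ℤ_p`-basis `{1, π}` of the last factor (bookkeeping: `π^{2m}𝒪 = p^m𝒪` has depths `(m, m)`, `π^{2m+1}𝒪 = p^m·(pℤ_p ⊕ ℤ_pπ)` has `(m+1, m)`).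
Stated through the existing `glat`, no new definition: the profile is the function below. [folklore] -/
theorem lastProfile_apply (a b : ℕ) (c : Idx j) :
    (fun c : Idx j => if c (Fin.last _) = 0 then a else b) c = if c (Fin.last _) = 0 then a else b := rfl

/-- **THE π-ADIC-SHAPE NO-GO at `j = 2`.** For `q = π^{e₀}` (`e₀ ≥ 1`) in a ramified quadratic `K_v`, the q-image has last-factor depths
`(⌈e₀/2⌉, ⌊e₀/2⌋)` and the Θ-image `q⁴ = p^{2e₀}·u` the isotropic depth `2e₀` (indeed ANY profile with all depths `≥ 2e₀`); since `⌊e₀/2⌋ < 2e₀`,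
the orbit-union of the Θ-image under ANY subgroup of the ball-preserving ⟨(Ind1)∪(Ind2)⟩ never covers the q-image. (COV covers only because its
Θ-image has a coordinate of depth `1 = ` the q-depth — `cov_depth_spread`.) [folklore] -/
theorem piAdicShape_not_covers {e₀ : ℕ} (he : 1 ≤ e₀) {kΘ : Idx (Setting.labelSucc (T := toyIndex) ⟨1, PinnedWitness.one_lt_lstar⟩) → ℕ}
    (hΘ : ∀ c, 2 * e₀ ≤ kΘ c) :
    ¬ glat p vQ (fun c : Idx (Setting.labelSucc (T := toyIndex) ⟨1, PinnedWitness.one_lt_lstar⟩) =>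
          if c (Fin.last _) = 0 then (e₀ + 1) / 2 else e₀ / 2) ⊆
        ⋃₀ {U | ∃ Φ ∈ covGroup, U = Φ _ vQ '' glat p vQ kΘ} := by
  refine not_covers_of_minDepth_lt p hΘ ⟨fun _ => 1, ?_⟩
  rw [if_neg (by decide)]
  omega

/-- The same with the honest ISOTROPIC Θ-image `p^{2e₀}·𝓘` spelled out (`q⁴·𝒪^{⊗3}` for `q = π^{e₀}`, `π² = p·u`). [folklore] -/
theorem piAdicShape_not_covers_isotropic {e₀ : ℕ} (he : 1 ≤ e₀) :
    ¬ glat p vQ (fun c : Idx (Setting.labelSucc (T := toyIndex) ⟨1, PinnedWitness.one_lt_lstar⟩) =>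
          if c (Fin.last _) = 0 then (e₀ + 1) / 2 else e₀ / 2) ⊆
        ⋃₀ {U | ∃ Φ ∈ covGroup, U = Φ _ vQ '' ball p (Setting.labelSucc (T := toyIndex) ⟨1, PinnedWitness.one_lt_lstar⟩) vQ (2 * e₀)} :=
  piAdicShape_not_covers p he (kΘ := fun _ => 2 * e₀) fun _ => le_rfl

end CoveringWitness

end Summit.ABC.IUTFork.Cor312Vol

end
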